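import Literature.IUT.HodgeTheaters.GlobalFrobenioidsArithmeticCor411GF
import Literature.IUT.HodgeTheaters.GlobalFrobenioidsBaseOnEquivalences
import Literature.AlgebraicGeometry.Frobenioids.ModelFrobenioidFiberProductPullback
import HarnessLib

/-!
# [IUTchI] Example 5.1 (iii) / Corollary 5.3 (i), the `⊚`-conjunct: [FrdI] Cor. 4.11 (ii) ON EQUIVALENCES of the
# RESTRICTIONS `ℱ^⊛(†𝒟^⊚)|_{†𝒟^⊚} = ℱ^⊛(†𝒟^⊚) ×_{†𝒟^⊛} †𝒟^⊚` of the GENUINE arithmetic global model Frobenioids —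
# the `1`-unique `Ψ^Base : ¹𝒟^⊚ ⥲ ²𝒟^⊚` under every `Ψ`, hence `HasUnder` / `UnderUnique` for `†ℱ^⊚ → †𝒟^⊚`

S. Mochizuki, *Inter-universal Teichmüller theory I*, kurims manuscript (May 2020), Example 5.1 (iii) pp. 125–126
("`†ℱ^⊚ := †ℱ^⊛|_{†𝒟^⊚}` … the restriction of `†ℱ^⊛` to `†𝒟^⊚` via the natural morphism `†𝒟^⊚ → †𝒟^⊛`"; (vi): the
discussion "may also be carried out for `†ℱ^⊚`") and Corollary 5.3 (i) p. 144 l. 1–13 ("the natural map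
`Isom(¹ℱ^⊚, ²ℱ^⊚) → Isom(Base(¹ℱ^⊚), Base(²ℱ^⊚))` is bijective") ([IUTchI] Cor 5.3 (i) p.144)
[claim: Mochizuki2012, status: disputed] — nothing of the series is asserted; no side is taken on [IUTchIII] Cor. 3.12.
The mathematics is [FrdI] Prop. 1.6 p. 27 and Cor. 4.11 (ii) pp. 91–92 [cite: MochizukiFrdI2008, Cor. 4.11 p.91].

PROOF-ONLY file (cell abc-iut; seat abc-iut-w4-d109; self-named row «C53i ⊚-TWIN» — the piece abc-iut-L6-t7's
`GlobalFrobenioidsBaseOnEquivalences.lean` names as missing: "the `†ℱ^⊚` twin wants the standard type of `†ℱ^⊚`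
(not in the tree)"), 0 definitions.  ROUTE (no standard-type transfer needed): abc-iut-w4-d109's L1 brick
`ModelFrobenioid.exists_fiberProduct_equivalence` identifies the fibre product `ℱ^⊛ ×_{ℬ(G)⁰} Dᶜ` of the MODEL
`ℱ^⊛ = ModelFrobenioid Δ.Φ Δ.B Δ.div` along ANY `T : Dᶜ ⥤ ℬ(G)⁰` with the model Frobenioid of the pulled-back data
`(Φ∘T, B∘T, Div∘T)` ON THE NOSE over `Dᶜ`; for the arithmetic data `Δ = arithAlong F ρ hρ` / `arith F` those data are
again "[FrdI] Ex. 6.3 data composed with a functor into `FinSubextCat`" (`T ⋙ subfieldFunctor`), so §1 of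
`GlobalFrobenioidsArithmeticCor411.lean` gives STANDARD TYPE etc., L1's `FrdI.cor411ii_ofFunctor` the `1`-unique
square at the model of the pulled-back data, and abc-iut-L6-t7's `OneUniqueSquare.of_equiv_top` / `of_iso_sides`
carry it back to the fibre product over its projection `pr₂ : ℱ^⊛ ×_{ℬ(G)⁰} Dᶜ → Dᶜ`.

* §1 — generic two-sided Cor. 4.11 for the model Frobenioids of composite data `(Φ∘Sᵢ, B∘Sᵢ, Div∘Sᵢ)`,
  `Sᵢ : Dᵢ ⥤ FinSubextCat Fᵢ Kᵢ`, `Dᵢ` connected, totally epimorphic, of FSM-type and slim: Frobenioid, typed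
  `Cor411ii` UNCONDITIONAL, `Cor411Setting`, `1`-unique `Ψ^Base` with rigid composites;
* §2 — the `⊚`-TWIN over `ℬ(G)⁰` (`Δᵢ = arithAlong Fᵢ ρᵢ hρᵢ`, any `Tᵢ : Dᵢ ⥤ ℬ(Gᵢ)⁰`): for every equivalence
  `Ψ : ℱ^⊛(¹𝒟^⊚) ×_{ℬ(G₁)⁰} D₁ ⥲ ℱ^⊛(²𝒟^⊚) ×_{ℬ(G₂)⁰} D₂` a `1`-unique `Ψ^Base : D₁ ⥲ D₂` over the projections, hence
  `CatIsomorphism.HasUnder` / `UnderUnique` for them; binders = {`Dᵢ` connected · totally epimorphic · FSM-type · slim}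
  — all four THEOREMS at `Dᵢ = ℬ(Hᵢ)⁰` for slim `Hᵢ` (`…_baseCat`), where NO slimness of `Gᵢ` is needed;
* §3 — the same over `ℬ(G_F)⁰` (`arith F`).

HONEST LIMITS.  This is the EXISTENCE + ESSENTIAL UNIQUENESS half of the `⊚`-conjunct of Cor. 5.3 (i) at the genuine
carriers (the natural map exists); its bijectivity (`DescendBijective`) = Ex. 5.1 (v)'s model case is FACT-policy
and NOT claimed.  The isomorph-level `†ℱ^⊚ = CFP F.toBase F.baseMor` of abc-iut-L5-t1's records is reached from here
by abc-iut-w4-d050's `GlobalFrobenioid.exists_fcirc_equivalence_fiberProduct` (not re-derived in this file).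
Nothing here bears on [IUTchIII] Cor. 3.12; typed ≠ proved elsewhere.
-/

noncomputable section

-- `(PreFrobenioidData.ofFunctor Φ F).base` / `ModelFrobenioid.data` / `arithAlong` fields unfold only at default
-- transparency.
set_option backward.isDefEq.respectTransparency false

namespace Literature.IUT.HodgeTheaters

open CategoryTheory Opposite
open Literature.AlgebraicGeometry.Frobenioids Literature.AnabelianGeometry.SemiGraphs
open Literature.AlgebraicGeometry.Frobenioids.QuasiTemperoid
open Literature.AlgebraicGeometry.Frobenioids.PreFrobenioid

universe v u

/-! ### §1. Two-sided [FrdI] Cor. 4.11 for model Frobenioids of composite arithmetic data -/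

section CompositeTwo

variable {F₁ : Type} [Field F₁] [NumberField F₁] {K₁ : Type} [Field K₁] [Algebra F₁ K₁] [IsGalois F₁ K₁]
variable {F₂ : Type} [Field F₂] [NumberField F₂] {K₂ : Type} [Field K₂] [Algebra F₂ K₂] [IsGalois F₂ K₂]
variable {D₁ : Type u} [Category.{v} D₁] {D₂ : Type u} [Category.{v} D₂]
  (S₁ : D₁ ⥤ FinSubextCat F₁ K₁) (S₂ : D₂ ⥤ FinSubextCat F₂ K₂)

/-- The model Frobenioid of `(Φ∘S, B∘S, Div∘S)` IS a Frobenioid for `D` connected, totally epimorphic and of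
FSM-type ([FrdI] Thm. 5.2 (ii); monoids pull back along functors out of FSM-type categories).
[cite: MochizukiFrdI2008, Thm. 5.2(ii) p.101] -/
theorem isFrobenioid_model_arith_comp (hc₁ : IsGraphConnected D₁) (he₁ : IsTotallyEpimorphic D₁)
    (hfsm₁ : IsOfFSMType D₁) :
    IsFrobenioid (ModelFrobenioid.toElem (S₁.op ⋙ arithDivisorFunctor F₁ K₁) (S₁.op ⋙ unitsFunctor F₁ K₁)
      (Functor.whiskerLeft S₁.op (divNatTrans F₁ K₁))) :=
  ModelFrobenioid.isFrobenioid (isMonoidOn_comp_of_isOfFSMType S₁ hfsm₁ (arithDivisorFunctor_isMonoidOn F₁ K₁))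
    (objectwise_comp S₁ (arithDivisorFunctor_isDivisorial F₁ K₁))
    (isMonoidOn_comp_of_isOfFSMType S₁ hfsm₁ (unitsFunctor_isMonoidOn F₁ K₁))
    (objectwise_comp S₁ (unitsFunctor_isGroupLike F₁ K₁)) hc₁ he₁

/-- **[FrdI] Cor. 4.11 (ii) AS TYPED, UNCONDITIONALLY**, for every equivalence between two model Frobenioids of
composite arithmetic data over connected, totally epimorphic bases of FSM-type (`FrdI.cor411ii_ofFunctor`).
[cite: MochizukiFrdI2008, Cor. 4.11 (ii) p.91] -/
theorem cor411ii_model_arith_comp (hc₁ : IsGraphConnected D₁) (he₁ : IsTotallyEpimorphic D₁) (hfsm₁ : IsOfFSMType D₁)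
    (hc₂ : IsGraphConnected D₂) (he₂ : IsTotallyEpimorphic D₂) (hfsm₂ : IsOfFSMType D₂)
    (Ψ : ModelFrobenioid (S₁.op ⋙ arithDivisorFunctor F₁ K₁) (S₁.op ⋙ unitsFunctor F₁ K₁)
        (Functor.whiskerLeft S₁.op (divNatTrans F₁ K₁)) ≌
      ModelFrobenioid (S₂.op ⋙ arithDivisorFunctor F₂ K₂) (S₂.op ⋙ unitsFunctor F₂ K₂)
        (Functor.whiskerLeft S₂.op (divNatTrans F₂ K₂))) :
    (ModelFrobenioid.data (S₁.op ⋙ arithDivisorFunctor F₁ K₁) (S₁.op ⋙ unitsFunctor F₁ K₁)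
        (Functor.whiskerLeft S₁.op (divNatTrans F₁ K₁))).Cor411ii
      (ModelFrobenioid.data (S₂.op ⋙ arithDivisorFunctor F₂ K₂) (S₂.op ⋙ unitsFunctor F₂ K₂)
        (Functor.whiskerLeft S₂.op (divNatTrans F₂ K₂))) Ψ :=
  FrdI.cor411ii_ofFunctor (isFrobenioid_model_arith_comp S₁ hc₁ he₁ hfsm₁)
    (isFrobenioid_model_arith_comp S₂ hc₂ he₂ hfsm₂) Ψ
    (objectwise_isPerfFactorial_arithDivisorFunctor_comp S₁) (objectwise_isPerfFactorial_arithDivisorFunctor_comp S₂)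

omit [IsGalois F₁ K₁] [IsGalois F₂ K₂] in
/-- **`Cor411Setting` HOLDS** for such `Ψ` when moreover the bases are SLIM (Div-slim ⟸ slim; standard type by
`isOfStandardType_model_arith_comp`; (b) idle). [cite: MochizukiFrdI2008, Cor. 4.11 p.91] -/
theorem cor411Setting_model_arith_comp (hc₁ : IsGraphConnected D₁) (he₁ : IsTotallyEpimorphic D₁)
    (hfsm₁ : IsOfFSMType D₁) (hsl₁ : IsSlim D₁) (hc₂ : IsGraphConnected D₂) (he₂ : IsTotallyEpimorphic D₂)
    (hfsm₂ : IsOfFSMType D₂) (hsl₂ : IsSlim D₂)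
    (Ψ : ModelFrobenioid (S₁.op ⋙ arithDivisorFunctor F₁ K₁) (S₁.op ⋙ unitsFunctor F₁ K₁)
        (Functor.whiskerLeft S₁.op (divNatTrans F₁ K₁)) ≌
      ModelFrobenioid (S₂.op ⋙ arithDivisorFunctor F₂ K₂) (S₂.op ⋙ unitsFunctor F₂ K₂)
        (Functor.whiskerLeft S₂.op (divNatTrans F₂ K₂))) :
    (ModelFrobenioid.data (S₁.op ⋙ arithDivisorFunctor F₁ K₁) (S₁.op ⋙ unitsFunctor F₁ K₁)
        (Functor.whiskerLeft S₁.op (divNatTrans F₁ K₁))).Cor411Setting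
      (ModelFrobenioid.data (S₂.op ⋙ arithDivisorFunctor F₂ K₂) (S₂.op ⋙ unitsFunctor F₂ K₂)
        (Functor.whiskerLeft S₂.op (divNatTrans F₂ K₂))) Ψ := by
  haveI : Nonempty D₁ := hc₁.nonempty
  haveI : Nonempty D₂ := hc₂.nonempty
  exact
    { divSlim := ⟨PreFrobenioidData.isDivSlim_of_isSlim _ hsl₁, PreFrobenioidData.isDivSlim_of_isSlim _ hsl₂⟩
      standard := ⟨isOfStandardType_model_arith_comp S₁ he₁ hfsm₁, isOfStandardType_model_arith_comp S₂ he₂ hfsm₂⟩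
      hypB := fun h₁ _ => absurd h₁ (not_isOfGroupLikeType_model_arith_comp S₁) }

/-- **The `1`-unique `Ψ^Base : D₁ ⥲ D₂` under `Ψ`**, rigid composites, for the model Frobenioids of composite
arithmetic data over connected, totally epimorphic, FSM-type, slim bases. [cite: MochizukiFrdI2008, Cor. 4.11 (ii) p.91] -/
theorem exists_oneUniqueSquare_base_model_arith_comp (hc₁ : IsGraphConnected D₁) (he₁ : IsTotallyEpimorphic D₁)
    (hfsm₁ : IsOfFSMType D₁) (hsl₁ : IsSlim D₁) (hc₂ : IsGraphConnected D₂) (he₂ : IsTotallyEpimorphic D₂)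
    (hfsm₂ : IsOfFSMType D₂) (hsl₂ : IsSlim D₂)
    (Ψ : ModelFrobenioid (S₁.op ⋙ arithDivisorFunctor F₁ K₁) (S₁.op ⋙ unitsFunctor F₁ K₁)
        (Functor.whiskerLeft S₁.op (divNatTrans F₁ K₁)) ≌
      ModelFrobenioid (S₂.op ⋙ arithDivisorFunctor F₂ K₂) (S₂.op ⋙ unitsFunctor F₂ K₂)
        (Functor.whiskerLeft S₂.op (divNatTrans F₂ K₂))) :
    ∃ ΨBase : D₁ ⥤ D₂,
      PreFrobenioidData.OneUniqueSquare Ψ.functor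
          (ModelFrobenioid.baseFunctor (S₁.op ⋙ arithDivisorFunctor F₁ K₁) (S₁.op ⋙ unitsFunctor F₁ K₁)
            (Functor.whiskerLeft S₁.op (divNatTrans F₁ K₁)))
          (ModelFrobenioid.baseFunctor (S₂.op ⋙ arithDivisorFunctor F₂ K₂) (S₂.op ⋙ unitsFunctor F₂ K₂)
            (Functor.whiskerLeft S₂.op (divNatTrans F₂ K₂))) ΨBase ∧
        IsRigidFunctor (Ψ.functor ⋙ ModelFrobenioid.baseFunctor (S₂.op ⋙ arithDivisorFunctor F₂ K₂)
          (S₂.op ⋙ unitsFunctor F₂ K₂) (Functor.whiskerLeft S₂.op (divNatTrans F₂ K₂))) ∧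
        IsRigidFunctor (ModelFrobenioid.baseFunctor (S₁.op ⋙ arithDivisorFunctor F₁ K₁) (S₁.op ⋙ unitsFunctor F₁ K₁)
          (Functor.whiskerLeft S₁.op (divNatTrans F₁ K₁)) ⋙ ΨBase) := by
  obtain ⟨ΨBase, hsq, hrig⟩ := cor411ii_model_arith_comp S₁ S₂ hc₁ he₁ hfsm₁ hc₂ he₂ hfsm₂ Ψ
    (cor411Setting_model_arith_comp S₁ S₂ hc₁ he₁ hfsm₁ hsl₁ hc₂ he₂ hfsm₂ hsl₂ Ψ)
  exact ⟨ΨBase, hsq, hrig hsl₁ hsl₂⟩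

end CompositeTwo

/-! ### §2. The `⊚`-twin over `†𝒟^⊛ = ℬ(G)⁰`: `ℱ^⊛(†𝒟^⊚) ×_{ℬ(G)⁰} Dᶜ` along any `T : Dᶜ ⥤ ℬ(G)⁰` -/

namespace GlobalDivisorData

section FcircAlong

variable {G₁ : ProfiniteGrp.{0}} (F₁ : Type) [Field F₁] [NumberField F₁] (ρ₁ : G₁ →ₜ* GalFbar F₁)
  (hρ₁ : Function.Surjective ρ₁) {D₁ : Type u} [Category.{v} D₁] (T₁ : D₁ ⥤ BaseCat G₁)
variable {G₂ : ProfiniteGrp.{0}} (F₂ : Type) [Field F₂] [NumberField F₂] (ρ₂ : G₂ →ₜ* GalFbar F₂)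
  (hρ₂ : Function.Surjective ρ₂) {D₂ : Type u} [Category.{v} D₂] (T₂ : D₂ ⥤ BaseCat G₂)

/-- **[FrdI] Cor. 4.11 (ii) at the RESTRICTIONS `ℱ^⊛(ⁱ𝒟^⊚) ×_{ℬ(Gᵢ)⁰} Dᵢ`** ([IUTchI] Ex. 5.1 (iii) `†ℱ^⊚ :=
†ℱ^⊛|_{†𝒟^⊚}`, at the model and along ANY `Tᵢ : Dᵢ ⥤ ℬ(Gᵢ)⁰`): for every equivalence `Ψ` of the two fibre products there
is a `1`-UNIQUE `Ψ^Base : D₁ ⥲ D₂` with `Ψ ⋙ pr₂ ≅ pr₂ ⋙ Ψ^Base` — as soon as `Dᵢ` is connected, totally epimorphic, of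
FSM-type and slim (no hypothesis on `Gᵢ`). ([IUTchI] Cor 5.3 (i) p.144) [claim: Mochizuki2012, status: disputed] -/
theorem exists_oneUniqueSquare_proj₂_fiberProduct_arithAlong (hc₁ : IsGraphConnected D₁)
    (he₁ : IsTotallyEpimorphic D₁) (hfsm₁ : IsOfFSMType D₁) (hsl₁ : IsSlim D₁) (hc₂ : IsGraphConnected D₂)
    (he₂ : IsTotallyEpimorphic D₂) (hfsm₂ : IsOfFSMType D₂) (hsl₂ : IsSlim D₂)
    (Ψ : PreFrobenioid.FiberProduct (ModelFrobenioid.toElem (arithAlong F₁ ρ₁ hρ₁).Φ (arithAlong F₁ ρ₁ hρ₁).B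
          (arithAlong F₁ ρ₁ hρ₁).div) T₁ ≌
      PreFrobenioid.FiberProduct (ModelFrobenioid.toElem (arithAlong F₂ ρ₂ hρ₂).Φ (arithAlong F₂ ρ₂ hρ₂).B
          (arithAlong F₂ ρ₂ hρ₂).div) T₂) :
    ∃ ΨBase : D₁ ⥤ D₂,
      PreFrobenioidData.OneUniqueSquare Ψ.functor
        (CFP.proj₂ (PreFrobenioid.baseFunctor (ModelFrobenioid.toElem (arithAlong F₁ ρ₁ hρ₁).Φ
          (arithAlong F₁ ρ₁ hρ₁).B (arithAlong F₁ ρ₁ hρ₁).div)) T₁)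
        (CFP.proj₂ (PreFrobenioid.baseFunctor (ModelFrobenioid.toElem (arithAlong F₂ ρ₂ hρ₂).Φ
          (arithAlong F₂ ρ₂ hρ₂).B (arithAlong F₂ ρ₂ hρ₂).div)) T₂) ΨBase := by
  haveI : IsGalois F₁ (Fbar F₁) := isGalois_fbar F₁
  haveI : IsGalois F₂ (Fbar F₂) := isGalois_fbar F₂
  obtain ⟨E₁, hE₁, -⟩ := ModelFrobenioid.exists_fiberProduct_equivalence (arithAlong F₁ ρ₁ hρ₁).Φ
    (arithAlong F₁ ρ₁ hρ₁).B (arithAlong F₁ ρ₁ hρ₁).div T₁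
  obtain ⟨E₂, hE₂, -⟩ := ModelFrobenioid.exists_fiberProduct_equivalence (arithAlong F₂ ρ₂ hρ₂).Φ
    (arithAlong F₂ ρ₂ hρ₂).B (arithAlong F₂ ρ₂ hρ₂).div T₂
  obtain ⟨B₀, hB₀, -⟩ := exists_oneUniqueSquare_base_model_arith_comp (T₁ ⋙ subfieldFunctor F₁ ρ₁ hρ₁)
    (T₂ ⋙ subfieldFunctor F₂ ρ₂ hρ₂) hc₁ he₁ hfsm₁ hsl₁ hc₂ he₂ hfsm₂ hsl₂ (E₁.symm.trans (Ψ.trans E₂))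
  have hB₀' : PreFrobenioidData.OneUniqueSquare (E₁.inverse ⋙ Ψ.functor ⋙ E₂.functor)
      (ModelFrobenioid.baseFunctor (T₁.op ⋙ (arithAlong F₁ ρ₁ hρ₁).Φ) (T₁.op ⋙ (arithAlong F₁ ρ₁ hρ₁).B)
        (Functor.whiskerLeft T₁.op (arithAlong F₁ ρ₁ hρ₁).div))
      (ModelFrobenioid.baseFunctor (T₂.op ⋙ (arithAlong F₂ ρ₂ hρ₂).Φ) (T₂.op ⋙ (arithAlong F₂ ρ₂ hρ₂).B)
        (Functor.whiskerLeft T₂.op (arithAlong F₂ ρ₂ hρ₂).div)) B₀ := hB₀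
  have h1 := hB₀'.of_equiv_top E₁ E₂ (T' := Ψ.functor) (E₁.funInvIdAssoc (Ψ.functor ⋙ E₂.functor))
  exact ⟨B₀, h1.of_iso_sides (eqToIso hE₁) (eqToIso hE₂)⟩

/-- **`HasUnder pr₂ pr₂` for the restrictions** — under every `Ψ` lies an equivalence `D₁ ⥲ D₂` (abc-iut-L6-t7's
bridge `CatIsomorphism.hasUnder_of_forall_oneUniqueSquare`). ([IUTchI] Cor 5.3 (i) p.144) [claim: Mochizuki2012, status: disputed] -/
theorem hasUnder_proj₂_fiberProduct_arithAlong (hc₁ : IsGraphConnected D₁) (he₁ : IsTotallyEpimorphic D₁)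
    (hfsm₁ : IsOfFSMType D₁) (hsl₁ : IsSlim D₁) (hc₂ : IsGraphConnected D₂) (he₂ : IsTotallyEpimorphic D₂)
    (hfsm₂ : IsOfFSMType D₂) (hsl₂ : IsSlim D₂) :
    CatIsomorphism.HasUnder
      (CFP.proj₂ (PreFrobenioid.baseFunctor (ModelFrobenioid.toElem (arithAlong F₁ ρ₁ hρ₁).Φ
        (arithAlong F₁ ρ₁ hρ₁).B (arithAlong F₁ ρ₁ hρ₁).div)) T₁)
      (CFP.proj₂ (PreFrobenioid.baseFunctor (ModelFrobenioid.toElem (arithAlong F₂ ρ₂ hρ₂).Φ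
        (arithAlong F₂ ρ₂ hρ₂).B (arithAlong F₂ ρ₂ hρ₂).div)) T₂) :=
  CatIsomorphism.hasUnder_of_forall_oneUniqueSquare fun Ψ =>
    exists_oneUniqueSquare_proj₂_fiberProduct_arithAlong F₁ ρ₁ hρ₁ T₁ F₂ ρ₂ hρ₂ T₂ hc₁ he₁ hfsm₁ hsl₁ hc₂ he₂
      hfsm₂ hsl₂ Ψ

/-- **`UnderUnique pr₂ pr₂` for the restrictions** — the equivalence `D₁ ⥲ D₂` under `Ψ` is unique up to isomorphism.
([IUTchI] Cor 5.3 (i) p.144) [claim: Mochizuki2012, status: disputed] -/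
theorem underUnique_proj₂_fiberProduct_arithAlong (hc₁ : IsGraphConnected D₁) (he₁ : IsTotallyEpimorphic D₁)
    (hfsm₁ : IsOfFSMType D₁) (hsl₁ : IsSlim D₁) (hc₂ : IsGraphConnected D₂) (he₂ : IsTotallyEpimorphic D₂)
    (hfsm₂ : IsOfFSMType D₂) (hsl₂ : IsSlim D₂) :
    CatIsomorphism.UnderUnique
      (CFP.proj₂ (PreFrobenioid.baseFunctor (ModelFrobenioid.toElem (arithAlong F₁ ρ₁ hρ₁).Φ
        (arithAlong F₁ ρ₁ hρ₁).B (arithAlong F₁ ρ₁ hρ₁).div)) T₁)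
      (CFP.proj₂ (PreFrobenioid.baseFunctor (ModelFrobenioid.toElem (arithAlong F₂ ρ₂ hρ₂).Φ
        (arithAlong F₂ ρ₂ hρ₂).B (arithAlong F₂ ρ₂ hρ₂).div)) T₂) :=
  CatIsomorphism.underUnique_of_forall_oneUniqueSquare fun Ψ =>
    exists_oneUniqueSquare_proj₂_fiberProduct_arithAlong F₁ ρ₁ hρ₁ T₁ F₂ ρ₂ hρ₂ T₂ hc₁ he₁ hfsm₁ hsl₁ hc₂ he₂
      hfsm₂ hsl₂ Ψ

end FcircAlong

section FcircAlongBaseCat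

variable {G₁ H₁ : ProfiniteGrp.{0}} (F₁ : Type) [Field F₁] [NumberField F₁] (ρ₁ : G₁ →ₜ* GalFbar F₁)
  (hρ₁ : Function.Surjective ρ₁) (T₁ : BaseCat H₁ ⥤ BaseCat G₁)
variable {G₂ H₂ : ProfiniteGrp.{0}} (F₂ : Type) [Field F₂] [NumberField F₂] (ρ₂ : G₂ →ₜ* GalFbar F₂)
  (hρ₂ : Function.Surjective ρ₂) (T₂ : BaseCat H₂ ⥤ BaseCat G₂)

/-- **The `⊚`-twin at `†𝒟^⊚ = ℬ(Hᵢ)⁰`** (print: `†𝒟^⊚ = ℬ(π₁(†𝒟^⊚))⁰` mapping to `†𝒟^⊛ = ℬ(π₁(†𝒟^⊛))⁰` along ANY functor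
`Tᵢ`): `HasUnder ∧ UnderUnique` for the projections of `ℱ^⊛(ⁱ𝒟^⊚) ×_{ℬ(Gᵢ)⁰} ℬ(Hᵢ)⁰`, MODULO ONLY `IsSlimGroup Hᵢ` —
connectedness, total epimorphicity and FSM-type of `ℬ(H)⁰` being theorems (abc-iut-w4-d050).
([IUTchI] Cor 5.3 (i) p.144) [claim: Mochizuki2012, status: disputed] -/
theorem hasUnder_and_underUnique_proj₂_fiberProduct_arithAlong_baseCat (hZ₁ : IsSlimGroup H₁)
    (hZ₂ : IsSlimGroup H₂) :
    CatIsomorphism.HasUnder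
        (CFP.proj₂ (PreFrobenioid.baseFunctor (ModelFrobenioid.toElem (arithAlong F₁ ρ₁ hρ₁).Φ
          (arithAlong F₁ ρ₁ hρ₁).B (arithAlong F₁ ρ₁ hρ₁).div)) T₁)
        (CFP.proj₂ (PreFrobenioid.baseFunctor (ModelFrobenioid.toElem (arithAlong F₂ ρ₂ hρ₂).Φ
          (arithAlong F₂ ρ₂ hρ₂).B (arithAlong F₂ ρ₂ hρ₂).div)) T₂) ∧
      CatIsomorphism.UnderUnique
        (CFP.proj₂ (PreFrobenioid.baseFunctor (ModelFrobenioid.toElem (arithAlong F₁ ρ₁ hρ₁).Φ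
          (arithAlong F₁ ρ₁ hρ₁).B (arithAlong F₁ ρ₁ hρ₁).div)) T₁)
        (CFP.proj₂ (PreFrobenioid.baseFunctor (ModelFrobenioid.toElem (arithAlong F₂ ρ₂ hρ₂).Φ
          (arithAlong F₂ ρ₂ hρ₂).B (arithAlong F₂ ρ₂ hρ₂).div)) T₂) :=
  ⟨hasUnder_proj₂_fiberProduct_arithAlong F₁ ρ₁ hρ₁ T₁ F₂ ρ₂ hρ₂ T₂ (isGraphConnected_baseCat H₁)
      (isTotallyEpimorphic_baseCat H₁) (isOfFSMType_baseCat H₁) (isSlim_baseCat_of_isSlimGroup H₁ hZ₁)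
      (isGraphConnected_baseCat H₂) (isTotallyEpimorphic_baseCat H₂) (isOfFSMType_baseCat H₂)
      (isSlim_baseCat_of_isSlimGroup H₂ hZ₂),
    underUnique_proj₂_fiberProduct_arithAlong F₁ ρ₁ hρ₁ T₁ F₂ ρ₂ hρ₂ T₂ (isGraphConnected_baseCat H₁)
      (isTotallyEpimorphic_baseCat H₁) (isOfFSMType_baseCat H₁) (isSlim_baseCat_of_isSlimGroup H₁ hZ₁)
      (isGraphConnected_baseCat H₂) (isTotallyEpimorphic_baseCat H₂) (isOfFSMType_baseCat H₂)
      (isSlim_baseCat_of_isSlimGroup H₂ hZ₂)⟩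

end FcircAlongBaseCat

/-! ### §3. The `⊚`-twin over `†𝒟^⊛ = ℬ(G_F)⁰` (`arith`) -/

section FcircArith

variable (F₁ : Type) [Field F₁] [NumberField F₁] {D₁ : Type u} [Category.{v} D₁] (T₁ : D₁ ⥤ BaseCat (absGalGrp F₁))
variable (F₂ : Type) [Field F₂] [NumberField F₂] {D₂ : Type u} [Category.{v} D₂] (T₂ : D₂ ⥤ BaseCat (absGalGrp F₂))

/-- **[FrdI] Cor. 4.11 (ii) at the restrictions `ℱ^⊛(†𝒟^⊚) ×_{ℬ(G_{Fᵢ})⁰} Dᵢ` of the arithmetic models over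
`ℬ(G_F)⁰`**: a `1`-unique `Ψ^Base : D₁ ⥲ D₂` over the projections under every `Ψ`, for `Dᵢ` connected, totally
epimorphic, FSM-type, slim. ([IUTchI] Cor 5.3 (i) p.144) [claim: Mochizuki2012, status: disputed] -/
theorem exists_oneUniqueSquare_proj₂_fiberProduct_arith (hc₁ : IsGraphConnected D₁) (he₁ : IsTotallyEpimorphic D₁)
    (hfsm₁ : IsOfFSMType D₁) (hsl₁ : IsSlim D₁) (hc₂ : IsGraphConnected D₂) (he₂ : IsTotallyEpimorphic D₂)
    (hfsm₂ : IsOfFSMType D₂) (hsl₂ : IsSlim D₂)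
    (Ψ : PreFrobenioid.FiberProduct (ModelFrobenioid.toElem (arith F₁).Φ (arith F₁).B (arith F₁).div) T₁ ≌
      PreFrobenioid.FiberProduct (ModelFrobenioid.toElem (arith F₂).Φ (arith F₂).B (arith F₂).div) T₂) :
    ∃ ΨBase : D₁ ⥤ D₂,
      PreFrobenioidData.OneUniqueSquare Ψ.functor
        (CFP.proj₂ (PreFrobenioid.baseFunctor (ModelFrobenioid.toElem (arith F₁).Φ (arith F₁).B (arith F₁).div)) T₁)
        (CFP.proj₂ (PreFrobenioid.baseFunctor (ModelFrobenioid.toElem (arith F₂).Φ (arith F₂).B (arith F₂).div)) T₂)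
        ΨBase := by
  haveI : IsGalois F₁ (Fbar F₁) := isGalois_fbar F₁
  haveI : IsGalois F₂ (Fbar F₂) := isGalois_fbar F₂
  obtain ⟨E₁, hE₁, -⟩ :=
    ModelFrobenioid.exists_fiberProduct_equivalence (arith F₁).Φ (arith F₁).B (arith F₁).div T₁
  obtain ⟨E₂, hE₂, -⟩ :=
    ModelFrobenioid.exists_fiberProduct_equivalence (arith F₂).Φ (arith F₂).B (arith F₂).div T₂
  obtain ⟨B₀, hB₀, -⟩ := exists_oneUniqueSquare_base_model_arith_comp (T₁ ⋙ galoisSubextOfFinite F₁)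
    (T₂ ⋙ galoisSubextOfFinite F₂) hc₁ he₁ hfsm₁ hsl₁ hc₂ he₂ hfsm₂ hsl₂ (E₁.symm.trans (Ψ.trans E₂))
  have hB₀' : PreFrobenioidData.OneUniqueSquare (E₁.inverse ⋙ Ψ.functor ⋙ E₂.functor)
      (ModelFrobenioid.baseFunctor (T₁.op ⋙ (arith F₁).Φ) (T₁.op ⋙ (arith F₁).B)
        (Functor.whiskerLeft T₁.op (arith F₁).div))
      (ModelFrobenioid.baseFunctor (T₂.op ⋙ (arith F₂).Φ) (T₂.op ⋙ (arith F₂).B)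
        (Functor.whiskerLeft T₂.op (arith F₂).div)) B₀ := hB₀
  have h1 := hB₀'.of_equiv_top E₁ E₂ (T' := Ψ.functor) (E₁.funInvIdAssoc (Ψ.functor ⋙ E₂.functor))
  exact ⟨B₀, h1.of_iso_sides (eqToIso hE₁) (eqToIso hE₂)⟩

/-- **`HasUnder ∧ UnderUnique` for the projections of the restrictions over `ℬ(G_F)⁰`**, binders on `Dᵢ` only.
([IUTchI] Cor 5.3 (i) p.144) [claim: Mochizuki2012, status: disputed] -/
theorem hasUnder_and_underUnique_proj₂_fiberProduct_arith (hc₁ : IsGraphConnected D₁)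
    (he₁ : IsTotallyEpimorphic D₁) (hfsm₁ : IsOfFSMType D₁) (hsl₁ : IsSlim D₁) (hc₂ : IsGraphConnected D₂)
    (he₂ : IsTotallyEpimorphic D₂) (hfsm₂ : IsOfFSMType D₂) (hsl₂ : IsSlim D₂) :
    CatIsomorphism.HasUnder
        (CFP.proj₂ (PreFrobenioid.baseFunctor (ModelFrobenioid.toElem (arith F₁).Φ (arith F₁).B (arith F₁).div)) T₁)
        (CFP.proj₂ (PreFrobenioid.baseFunctor (ModelFrobenioid.toElem (arith F₂).Φ (arith F₂).B (arith F₂).div)) T₂) ∧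
      CatIsomorphism.UnderUnique
        (CFP.proj₂ (PreFrobenioid.baseFunctor (ModelFrobenioid.toElem (arith F₁).Φ (arith F₁).B (arith F₁).div)) T₁)
        (CFP.proj₂ (PreFrobenioid.baseFunctor (ModelFrobenioid.toElem (arith F₂).Φ (arith F₂).B (arith F₂).div))
          T₂) :=
  ⟨CatIsomorphism.hasUnder_of_forall_oneUniqueSquare fun Ψ =>
      exists_oneUniqueSquare_proj₂_fiberProduct_arith F₁ T₁ F₂ T₂ hc₁ he₁ hfsm₁ hsl₁ hc₂ he₂ hfsm₂ hsl₂ Ψ,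
    CatIsomorphism.underUnique_of_forall_oneUniqueSquare fun Ψ =>
      exists_oneUniqueSquare_proj₂_fiberProduct_arith F₁ T₁ F₂ T₂ hc₁ he₁ hfsm₁ hsl₁ hc₂ he₂ hfsm₂ hsl₂ Ψ⟩

/-- **… with NO hypothesis but the slimness of `Hᵢ` at `Dᵢ = ℬ(Hᵢ)⁰`** (any `Tᵢ : ℬ(Hᵢ)⁰ ⥤ ℬ(G_{Fᵢ})⁰`).
([IUTchI] Cor 5.3 (i) p.144) [claim: Mochizuki2012, status: disputed] -/
theorem hasUnder_and_underUnique_proj₂_fiberProduct_arith_baseCat {H₁ H₂ : ProfiniteGrp.{0}}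
    (T₁ : BaseCat H₁ ⥤ BaseCat (absGalGrp F₁)) (T₂ : BaseCat H₂ ⥤ BaseCat (absGalGrp F₂))
    (hZ₁ : IsSlimGroup H₁) (hZ₂ : IsSlimGroup H₂) :
    CatIsomorphism.HasUnder
        (CFP.proj₂ (PreFrobenioid.baseFunctor (ModelFrobenioid.toElem (arith F₁).Φ (arith F₁).B (arith F₁).div)) T₁)
        (CFP.proj₂ (PreFrobenioid.baseFunctor (ModelFrobenioid.toElem (arith F₂).Φ (arith F₂).B (arith F₂).div)) T₂) ∧
      CatIsomorphism.UnderUnique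
        (CFP.proj₂ (PreFrobenioid.baseFunctor (ModelFrobenioid.toElem (arith F₁).Φ (arith F₁).B (arith F₁).div)) T₁)
        (CFP.proj₂ (PreFrobenioid.baseFunctor (ModelFrobenioid.toElem (arith F₂).Φ (arith F₂).B (arith F₂).div))
          T₂) :=
  hasUnder_and_underUnique_proj₂_fiberProduct_arith F₁ T₁ F₂ T₂ (isGraphConnected_baseCat H₁)
    (isTotallyEpimorphic_baseCat H₁) (isOfFSMType_baseCat H₁) (isSlim_baseCat_of_isSlimGroup H₁ hZ₁)
    (isGraphConnected_baseCat H₂) (isTotallyEpimorphic_baseCat H₂) (isOfFSMType_baseCat H₂)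
    (isSlim_baseCat_of_isSlimGroup H₂ hZ₂)

end FcircArith

end GlobalDivisorData

end Literature.IUT.HodgeTheaters

end
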